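import Literature.AlgebraicGeometry.Frobenioids.ModelFrobenioid
import Mathlib.GroupTheory.QuotientGroup.Defs
import HarnessLib

/-!
# Frobenioids I, §5: subfunctors of groups `Ψ ⊆ Φ^gp`, the quotients `Φ^gp/Ψ`, the model
# Frobenioid of `(Φ, Ψ ↪ Φ^gp)`, and the zero monoid `0_D`

Mochizuki, *The geometry of Frobenioids I: the general theory*, Kyushu J. Math. **62** (2008)
293–400 [cite: MochizukiFrdI2008, Prop. 4.4 (iii) p.83] [cite: MochizukiFrdI2008, Thm. 5.1 p.96]
[cite: MochizukiFrdI2008, Prop. 5.3 p.103].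

The plumbing shared by the §5-tail files (Theorem 5.1, Propositions 5.3, 5.5): Proposition 4.4
(iii) (p. 83) produces "a unique subfunctor of groups `Φ^birat ⊆ Φ^gp`"; Theorem 5.1 (p. 96) forms
`Pic_Φ(A) := Φ^gp(A)/Φ^birat(A)` and the maps `Φ(θ)` on it; Proposition 5.3 (p. 103) and
Proposition 5.5 (iv) (p. 104) form "the model Frobenioid associated to the divisor monoid `Φ` and the
rational function monoid `Φ^birat`" (data `Φ, Φ^birat, Φ^birat ↪ Φ^gp` fed to Theorem 5.2 (i)), and
Proposition 4.4 (i) (p. 83) uses the zero monoid `0_D` ("the monoid on `D` all of whose values on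
objects of `D` are equal to the monoid with one element").

This file supplies these constructions for an ARBITRARY subfunctor of groups `Ψ ⊆ Φ^gp` of a monoid
`Φ` on `D` (a family of subgroups `Ψ(X) ⊆ Φ(X)^gp` stable under the pull-back maps
`Φ(f) : Φ(Y)^gp → Φ(X)^gp`): `GpSubfunctor Φ`; `Ψ.Pic X := Φ^gp(X)/Ψ(X)` with `Ψ.picPull f`;
`Ψ.toMonoid : Dᵒᵖ ⥤ CommMonCat` (the group-like monoid `Ψ` on `D`) with the inclusion
`Ψ.incl : Ψ.toMonoid ⟶ Φ^gp`; `Ψ.ModelOf :=` the model Frobenioid `ModelFrobenioid Φ Ψ.toMonoid Ψ.incl`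
of Theorem 5.2 (i) (file `ModelFrobenioid.lean`); and `zeroMonoidOn D = 0_D`. The subfunctor
`Φ^birat` itself (Prop. 4.4 (iii)) is NOT defined here (it belongs to the §4 files, seat
abc-iut-L1-t3); the §5 statements take it as a parameter of type `GpSubfunctor Φ`.
Multiplicative rendering of the paper's additive monoids as elsewhere in this directory
(`M^gp = Algebra.GrothendieckGroup M`).
-/

namespace Literature.AlgebraicGeometry.Frobenioids

open CategoryTheory Opposite

universe w v u

variable {D : Type u} [Category.{v} D]

/-! ### Subfunctors of groups of `Φ^gp` -/

/-- A *subfunctor of groups* `Ψ ⊆ Φ^gp` of the groupification of a monoid `Φ` on `D` (the shape of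
"the unique subfunctor of groups `Φ^birat ⊆ Φ^gp`" of FrdI Prop. 4.4 (iii), p. 83): a subgroup
`Ψ(X) ⊆ Φ(X)^gp` for every `X ∈ Ob(D)`, stable under the pull-back maps `Φ(f) : Φ(Y)^gp → Φ(X)^gp`
of `f : X → Y`. [cite: MochizukiFrdI2008, Prop. 4.4 (iii) p.83] -/
structure GpSubfunctor (Φ : Dᵒᵖ ⥤ CommMonCat.{w}) where
  /-- `Ψ(X) ⊆ Φ(X)^gp` -/
  carrier : ∀ X : D, Subgroup (Algebra.GrothendieckGroup (Φ.obj (op X)))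
  /-- stability under pull-back: `Φ(f)(Ψ(Y)) ⊆ Ψ(X)` for `f : X → Y` -/
  pull_mem : ∀ {X Y : D} (f : X ⟶ Y) {c : Algebra.GrothendieckGroup (Φ.obj (op Y))},
    c ∈ carrier Y → pullGp Φ f c ∈ carrier X

namespace GpSubfunctor

variable {Φ : Dᵒᵖ ⥤ CommMonCat.{w}} (Ψ : GpSubfunctor Φ)

/-- `Φ^gp(X)/Ψ(X)`; for `Ψ = Φ^birat` this is `Pic_Φ(A) := Φ^gp(A)/Φ^birat(A)` of Theorem 5.1
(p. 96, "[cf. Proposition 4.4, (iii)]"). [cite: MochizukiFrdI2008, Thm. 5.1 p.96] -/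
abbrev Pic (X : D) : Type w := Algebra.GrothendieckGroup (Φ.obj (op X)) ⧸ Ψ.carrier X

/-- The homomorphism `Φ^gp(Y)/Ψ(Y) → Φ^gp(X)/Ψ(X)` induced by `Φ(f)` for `f : X → Y` (the map
written "`(Φ(θ))(β')`" in Theorem 5.1 (ii), p. 97). [cite: MochizukiFrdI2008, Thm. 5.1 (ii) p.97] -/
noncomputable def picPull {X Y : D} (f : X ⟶ Y) : Ψ.Pic Y →* Ψ.Pic X :=
  QuotientGroup.map (Ψ.carrier Y) (Ψ.carrier X) (pullGp Φ f) fun _ hc => Ψ.pull_mem f hc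

/-- The restriction `Ψ(Y) → Ψ(X)` of `Φ(f)` for `f : X → Y` (well defined by stability).
[cite: MochizukiFrdI2008, Prop. 4.4 (iii) p.83] -/
noncomputable def pullRestrict {X Y : D} (f : X ⟶ Y) : Ψ.carrier Y →* Ψ.carrier X :=
  ((pullGp Φ f).comp (Ψ.carrier Y).subtype).codRestrict (Ψ.carrier X) fun c => Ψ.pull_mem f c.2

/-- `Ψ(Y) → Ψ(X)` is `Φ(f)` on underlying elements. [cite: MochizukiFrdI2008, Prop. 4.4 (iii) p.83] -/
@[simp] theorem coe_pullRestrict {X Y : D} (f : X ⟶ Y) (c : Ψ.carrier Y) :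
    (Ψ.pullRestrict f c : Algebra.GrothendieckGroup (Φ.obj (op X))) = pullGp Φ f c := rfl

/-- `Ψ` regarded as a (group-like) monoid on `D`: `X ↦ Ψ(X)`, `f ↦ Φ(f)|_Ψ` — the "rational function
monoid" slot of Theorem 5.2 when one forms "the model Frobenioid associated to the divisor monoid `Φ`
and the rational function monoid `Φ^birat`" (Prop. 5.3 p. 103, Prop. 5.5 (iv) p. 104).
[cite: MochizukiFrdI2008, Prop. 5.3 p.103] -/
noncomputable def toMonoid : Dᵒᵖ ⥤ CommMonCat.{w} where
  obj X := CommMonCat.of (Ψ.carrier (unop X))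
  map f := CommMonCat.ofHom (Ψ.pullRestrict f.unop)
  map_id X := by
    apply CommMonCat.hom_ext
    rw [CommMonCat.hom_ofHom, CommMonCat.hom_id]
    ext c
    change pullGp Φ (𝟙 (unop X)) (c : Algebra.GrothendieckGroup (Φ.obj X)) = c
    exact pullGp_id (Φ := Φ) (unop X) c
  map_comp f g := by
    apply CommMonCat.hom_ext
    rw [CommMonCat.hom_ofHom, CommMonCat.hom_comp, CommMonCat.hom_ofHom, CommMonCat.hom_ofHom]
    ext c
    change pullGp Φ (g.unop ≫ f.unop) (c : Algebra.GrothendieckGroup (Φ.obj _)) =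
      pullGp Φ g.unop (pullGp Φ f.unop c)
    exact pullGp_comp (Φ := Φ) g.unop f.unop c

/-- Every element of `Ψ(X)` is invertible in the monoid `Ψ(X)` ("group-like", as required of the
rational function monoid `B` in Theorem 5.2, p. 100). [cite: MochizukiFrdI2008, Thm. 5.2 p.100] -/
theorem isUnit_toMonoid (X : Dᵒᵖ) (b : Ψ.toMonoid.obj X) : IsUnit b := by
  exact Group.isUnit (α := Ψ.carrier (unop X)) b

/-- The inclusion `Ψ ↪ Φ^gp` as a homomorphism of monoids on `D` (the `Div_B` slot of Theorem 5.2: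
"`Φ^birat ↪ Φ^gp`", Prop. 5.5 (iv) p. 104). [cite: MochizukiFrdI2008, Prop. 5.5 (iv) p.104] -/
noncomputable def incl : Ψ.toMonoid ⟶ monoidGp Φ where
  app X := CommMonCat.ofHom (Ψ.carrier (unop X)).subtype
  naturality _ _ _ := CommMonCat.hom_ext (MonoidHom.ext fun _ => rfl)

/-- With `Ψ` as rational function monoid, the `Φ^birat ⊆ Φ^gp` of Theorem 5.2 (the image of `Div_B`,
`biratSubmonoid`) is `Ψ` itself. [cite: MochizukiFrdI2008, Thm. 5.2 p.100] -/
theorem mem_biratSubmonoid_incl_iff (X : Dᵒᵖ) (c : Algebra.GrothendieckGroup (Φ.obj X)) :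
    c ∈ biratSubmonoid Φ Ψ.toMonoid Ψ.incl X ↔ c ∈ Ψ.carrier (unop X) := by
  constructor
  · rintro ⟨b, rfl⟩
    exact (b : Ψ.carrier (unop X)).2
  · intro hc
    exact ⟨(⟨c, hc⟩ : Ψ.carrier (unop X)), rfl⟩

/-- "The model Frobenioid associated to the divisor monoid `Φ` and the rational function monoid `Ψ`"
(`Ψ ⊆ Φ^gp` a subfunctor of groups, with `Div_B` the inclusion), i.e. the category of Theorem 5.2 (i)
for the data `(Φ, Ψ, Ψ ↪ Φ^gp)` — used with `Ψ = Φ^birat` (`C^un-tr`, Prop. 5.3), with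
`Ψ = ℝ · Φ^birat ⊆ (Φ^rlf)^gp` (`C^rlf`, Prop. 5.3) and with `Ψ = (Φ^birat)^pf` (`(C^un-tr)^pf`).
[cite: MochizukiFrdI2008, Prop. 5.3 p.103] -/
abbrev ModelOf : Type (max u w) := ModelFrobenioid Φ Ψ.toMonoid Ψ.incl

end GpSubfunctor

/-! ### The zero monoid `0_D` -/

variable (D) in
/-- `0_D`, "the monoid on `D` all of whose values on objects of `D` are equal to the monoid with one
element [so `F_{0_D}` is the product category of `D` with the one-object category determined by the
monoid `N_{≥1}`]" (FrdI Prop. 4.4 (i), p. 83). [cite: MochizukiFrdI2008, Prop. 4.4 (i) p.83] -/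
def zeroMonoidOn : Dᵒᵖ ⥤ CommMonCat.{w} :=
  (Functor.const Dᵒᵖ).obj (CommMonCat.of PUnit.{w + 1})

/-- The values of `0_D` have exactly one element. [cite: MochizukiFrdI2008, Prop. 4.4 (i) p.83] -/
instance subsingleton_zeroMonoidOn_obj (X : Dᵒᵖ) : Subsingleton ((zeroMonoidOn.{w} D).obj X) :=
  inferInstanceAs (Subsingleton PUnit)

end Literature.AlgebraicGeometry.Frobenioids
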